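/-
Origin: expansion seat `planner-pub-hodgecm-prl1-g4-0`, handover #3 2026-08-18T07:30:11Z (`HOME/pub-hodgecm-prl1-g4/lean/Prl1g4/QuotientModelOfLattice.lean`, md5 99897f9e, 251 lines);
landed by the gen-7 packager in gate run 26 as `HodgeCM/Automorphic/QuotientModelOfLattice.lean` (verbatim).
-/
/-
Origin: HOME/pub-hodgecm-prl1-g4/lean/Prl1g4/QuotientModelOfLattice.lean — session planner-pub-hodgecm-prl1-g4-0
(unit pub-hodgecm-prl1-g4, EXPANSION PROVER a-1 gen 4, STRATEGY 1 CONSTRUCT; lineage prl1).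
Intended final place (packager's call): `HodgeCM/Automorphic/QuotientModelOfLattice.lean`.
NEW, ADDITIVE LEAF; WIP imports ↦ landed names: `Prl1g3.ModelCarrier` ↦ `HodgeCM.Automorphic.ModelCarrier`
(prl1-g3 #12, 529480c970b9, run 25), `Pv09g4.DiscreteFundamentalDomain` ↦ `HodgeCM.PerL34.DiscreteFundamentalDomain`
(pv09-g4 #2(a), 1d1eac5dfd27, run 25).  Lands AFTER both.  My `lean/{Prl1g3,Pv09g4}/` copies are byte MIRRORS —
DO NOT LAND.
KIND: KERNEL (Mathlib measure theory) + one CONSTRUCTION — nothing cited as a hypothesis, nothing posited.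
-/
import Summits.HodgeConjecture.HodgeCM.Automorphic.ModelCarrier
import Summits.HodgeConjecture.HodgeCM.PerL34.DiscreteFundamentalDomain_2

/-!
# `QuotientModel` from a cocompact lattice alone; a group with a cocompact lattice is unimodular

prl1-g3's `HodgeCM.QuotientModel` (the model of `[U(W)] = U(W)(L₀)\U(W)(𝔸)` and of `[G_U]` consumed by every
END STATE over models: `Assembly.realisationExists_ofModels`, pv15-g2's `…_ofKernelModelData`, my
`…_ofWeilModelData`) is a record of DATA: a locally compact group `G`, a discrete countable CLOSED cocompact
subgroup `Γ`, a regular Haar measure `μ` that is ALSO RIGHT INVARIANT (unimodularity of `G`), and a measurable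
fundamental domain `𝓕` for `Γ` acting on the right.  pv09-g4's `DiscreteFundamentalDomain` makes `𝓕` a
construction ("`Γ` discrete, `G ⧸ Γ` compact, `G` second countable", its module docstring).  This file finishes
the job:

* §1 (Mathlib only) **a locally compact group carrying a lattice is unimodular** — for a left Haar measure `μ`
  (inner regular) and a countable subgroup `Γ` with a fundamental domain `𝓕` for LEFT multiplication,
  `0 < μ 𝓕 < ∞`: the right translate `𝓕g` is again a fundamental domain (left and right multiplication
  commute), so `μ(𝓕g) = μ(𝓕)` (Mathlib `IsFundamentalDomain.measure_eq`), while `μ(𝓕g) = Δ(g⁻¹) μ(𝓕)`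
  (Mathlib `map_right_mul_eq_modularCharacterFun_smul`); hence `Δ ≡ 1` and `μ` is right invariant
  (`isMulRightInvariant_of_isFundamentalDomain`).  Raghunathan, *Discrete subgroups of Lie groups* (1972) Ch. I
  Remark 1.9; Bekka–de la Harpe–Valette, *Kazhdan's property (T)* Prop. B.2.2 (ii) — folklore, PROVED here, not
  cited (proof shape as in the harness tree's `Literature/NumberTheory/Automorphic/LatticeUnimodular.lean`,
  re-proved against this package's Mathlib, not vendored);
* §2 the cocompact discrete case WITHOUT normality of `Γ` for the LEFT action (pv09-g4 has the right action in
  general and the left action for `[Γ.Normal]`; its `CocompactFundamentalDomain` drops second countability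
  instead): a compact set meeting every right coset `Γx` is `K⁻¹` for pv09-g4's compact `K` meeting every left
  coset (`exists_isCompact_cover_left_of_cocompact`), whence a relatively compact measurable left fundamental
  domain (`exists_isFundamentalDomain_left_finite_of_cocompact`) and
  **`isMulRightInvariant_of_cocompactLattice`**: every Haar measure of a locally compact second countable group
  with a discrete cocompact subgroup is right invariant;
* §3 **`QuotientModel.ofLattice G Γ`** for `[LocallyCompactSpace G] [T2Space G] [SecondCountableTopology G]`,
  `Γ` discrete and cocompact: Borel σ-algebra, `Countable Γ` (pv09-g4), `Γ` closed (Mathlib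
  `Subgroup.isClosed_of_discrete`), `μ := Measure.haar` (regular), UNIMODULARITY (§2), `𝓕` (pv09-g4) — every
  field other than `(G, Γ)` a theorem or a construction; and `FirstCountableTopology (ofLattice G Γ).G` (the
  hypothesis `hfc` of the END STATEs, for such models).

So for the intended dictionary (`G = U(W)(𝔸)`, `Γ = U(W)(L₀)`; `G = G_U(𝔸)`, `Γ = G_U(L⁺)`) the model DATA is:
the topological group, its discreteness-of-rational-points and its compactness-of-the-quotient (anisotropic
unitary groups: Borel–Harish-Chandra / Godement compactness criterion) — and nothing measure-theoretic.
-/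

set_option autoImplicit false

noncomputable section

open MeasureTheory Measure Set Filter Topology
open scoped ENNReal NNReal Pointwise

namespace HodgeCM

namespace CocompactLattice

/-! ## 1. A group with a finite-covolume lattice is unimodular -/

section Unimodular

variable {G : Type*} [Group G] [TopologicalSpace G] [IsTopologicalGroup G] [MeasurableSpace G]
  [BorelSpace G] (Γ : Subgroup G) (μ : Measure G)

/-- Right translates of fundamental domains for the left multiplication action of a subgroup are fundamental
domains (for a left-invariant measure). -/
theorem isFundamentalDomain_image_mul_right [SecondCountableTopology G] [SFinite μ]
    [μ.IsMulLeftInvariant] {𝓕 : Set G} (h𝓕 : IsFundamentalDomain Γ 𝓕 μ) (g : G) :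
    IsFundamentalDomain Γ ((· * g) '' 𝓕) μ := by
  have hq : QuasiMeasurePreserving (Equiv.mulRight g).symm μ μ :=
    quasiMeasurePreserving_mul_right μ g⁻¹
  have h := h𝓕.image_of_equiv (Equiv.mulRight g) hq (Equiv.refl _) fun γ x => ?_
  · simpa only [Equiv.coe_mulRight] using h
  · show (γ • x) * g = γ • (x * g)
    exact mul_assoc _ _ _

/-- All right translates of a fundamental domain of a countable subgroup have the same measure. -/
theorem measure_image_mul_right_eq [SecondCountableTopology G] [SFinite μ] [μ.IsMulLeftInvariant]
    [Countable Γ] {𝓕 : Set G} (h𝓕 : IsFundamentalDomain Γ 𝓕 μ) (g : G) :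
    μ ((· * g) '' 𝓕) = μ 𝓕 :=
  (isFundamentalDomain_image_mul_right Γ μ h𝓕 g).measure_eq h𝓕

/-- **The modular function of a group with a lattice is trivial**: `Δ(g⁻¹) μ(𝓕) = (map (· g⁻¹) μ)(𝓕) =
μ(𝓕 g) = μ(𝓕)` with `0 < μ(𝓕) < ∞` (Raghunathan 1972, Ch. I Rem. 1.9). -/
theorem modularCharacterFun_eq_one_of_isFundamentalDomain [LocallyCompactSpace G]
    [SecondCountableTopology G] [IsHaarMeasure μ] [InnerRegular μ] [Countable Γ] {𝓕 : Set G}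
    (h𝓕 : IsFundamentalDomain Γ 𝓕 μ) (h0 : μ 𝓕 ≠ 0) (htop : μ 𝓕 ≠ ∞) (g : G) :
    modularCharacterFun g = 1 := by
  suffices h : ∀ g : G, modularCharacterFun g⁻¹ = 1 by simpa using h g⁻¹
  intro g
  have hmap : Measure.map (· * g⁻¹) μ = modularCharacterFun g⁻¹ • μ :=
    map_right_mul_eq_modularCharacterFun_smul μ g⁻¹
  have h1 : μ ((· * g) '' 𝓕) = Measure.map (· * g⁻¹) μ 𝓕 := by
    rw [image_mul_right, (measurableEmbedding_mulRight g⁻¹).map_apply]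
  have h2 : μ ((· * g) '' 𝓕) = μ 𝓕 := measure_image_mul_right_eq Γ μ h𝓕 g
  rw [h2, hmap, Measure.smul_apply] at h1
  have h3 : ((modularCharacterFun g⁻¹ : ℝ≥0) : ℝ≥0∞) * μ 𝓕 = 1 * μ 𝓕 := by
    rw [one_mul]
    exact h1.symm
  exact_mod_cast (ENNReal.mul_left_inj h0 htop).1 h3

/-- **A locally compact group with a finite-covolume lattice is unimodular**: a left Haar measure of a locally
compact second countable group with a countable subgroup admitting a left fundamental domain of finite non-zero
measure is right invariant (Raghunathan 1972, Ch. I Rem. 1.9; Bekka–de la Harpe–Valette Prop. B.2.2 (ii)). -/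
theorem isMulRightInvariant_of_isFundamentalDomain [LocallyCompactSpace G]
    [SecondCountableTopology G] [IsHaarMeasure μ] [InnerRegular μ] [Countable Γ] {𝓕 : Set G}
    (h𝓕 : IsFundamentalDomain Γ 𝓕 μ) (h0 : μ 𝓕 ≠ 0) (htop : μ 𝓕 ≠ ∞) :
    μ.IsMulRightInvariant := by
  refine ⟨fun g => ?_⟩
  rw [map_right_mul_eq_modularCharacterFun_smul μ g,
    modularCharacterFun_eq_one_of_isFundamentalDomain Γ μ h𝓕 h0 htop g, one_smul]

end Unimodular

/-! ## 2. Cocompact discrete subgroups: the left action without normality; unimodularity -/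

section Cocompact

open HodgeCM.PerL34.DiscreteFD

variable {G : Type*} [Group G] [TopologicalSpace G] [IsTopologicalGroup G] [LocallyCompactSpace G]
  (Γ : Subgroup G) [DiscreteTopology Γ] [CompactSpace (G ⧸ Γ)]

omit [DiscreteTopology Γ] in
/-- If `G ⧸ Γ` is compact, some compact closed `K ⊆ G` meets every RIGHT coset `Γx`, i.e. every orbit of the
LEFT multiplication action of `Γ` (no normality: `K := K₀⁻¹` for pv09-g4's `K₀` meeting every left coset). -/
theorem exists_isCompact_cover_left_of_cocompact :
    ∃ K : Set G, IsCompact K ∧ IsClosed K ∧ ∀ x : G, ∃ γ : Γ, γ • x ∈ K := by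
  obtain ⟨K, hKc, hKcl, hK⟩ := exists_isCompact_cover_op Γ
  refine ⟨K⁻¹, hKc.inv, hKcl.inv, fun x => ?_⟩
  obtain ⟨γ, hγ⟩ := hK x⁻¹
  rw [Subgroup.smul_def, MulOpposite.smul_eq_mul_unop] at hγ
  have hmem : (MulOpposite.unop (γ : Gᵐᵒᵖ))⁻¹ ∈ Γ := inv_mem (Subgroup.mem_op.1 γ.2)
  refine ⟨⟨_, hmem⟩, ?_⟩
  rw [Subgroup.mk_smul, smul_eq_mul, Set.mem_inv, mul_inv_rev, inv_inv]
  exact hγ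

variable [SecondCountableTopology G] [MeasurableSpace G] [BorelSpace G]

/-- **Cocompact case, left action, no normality**: a relatively compact measurable fundamental domain in the
exact sense `∀ x, ∃! γ : Γ, γ • x ∈ 𝓕`. -/
theorem exists_fundamentalDomain_left_relCompact_of_cocompact :
    ∃ 𝓕 : Set G, MeasurableSet 𝓕 ∧ IsCompact (closure 𝓕) ∧ ∀ x : G, ∃! γ : Γ, γ • x ∈ 𝓕 := by
  obtain ⟨K, hKc, hKcl, hK⟩ := exists_isCompact_cover_left_of_cocompact Γ
  obtain ⟨𝓕, h𝓕K, h𝓕m, h⟩ := exists_fundamentalDomain_left_subset Γ hKcl.measurableSet hK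
  exact ⟨𝓕, h𝓕m, hKc.of_isClosed_subset isClosed_closure (closure_minimal h𝓕K hKcl), h⟩

/-- Measure form: a measurable left fundamental domain of finite measure, for every measure finite on compact
sets. -/
theorem exists_isFundamentalDomain_left_finite_of_cocompact (μ : Measure G) [IsFiniteMeasureOnCompacts μ] :
    ∃ 𝓕 : Set G, MeasurableSet 𝓕 ∧ IsFundamentalDomain Γ 𝓕 μ ∧ IsCompact (closure 𝓕) ∧ μ 𝓕 < ⊤ := by
  obtain ⟨𝓕, h𝓕m, hc, h⟩ := exists_fundamentalDomain_left_relCompact_of_cocompact Γ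
  exact ⟨𝓕, h𝓕m, isFundamentalDomain_of_existsUnique h𝓕m h μ, hc,
    (measure_mono subset_closure).trans_lt hc.measure_lt_top⟩

include Γ in
/-- **A locally compact second countable group with a discrete cocompact subgroup is unimodular**: every Haar
measure is right invariant. -/
theorem isMulRightInvariant_of_cocompactLattice (μ : Measure G) [IsHaarMeasure μ] :
    μ.IsMulRightInvariant := by
  haveI : Countable Γ := countable_of_discrete Γ
  obtain ⟨𝓕, -, h𝓕, -, htop⟩ := exists_isFundamentalDomain_left_finite_of_cocompact Γ μ
  have hμ : μ ≠ 0 := fun h => (isOpen_univ.measure_ne_zero μ univ_nonempty) (by simp [h])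
  exact isMulRightInvariant_of_isFundamentalDomain Γ μ h𝓕 (h𝓕.measure_ne_zero hμ) htop.ne

end Cocompact

end CocompactLattice

/-! ## 3. The quotient model of a cocompact lattice -/

namespace QuotientModel

open HodgeCM.PerL34.DiscreteFD

/-- **`QuotientModel` from a cocompact lattice**: `G` locally compact Hausdorff second countable, `Γ ≤ G` discrete
with `G ⧸ Γ` compact.  Borel σ-algebra; `Γ` countable and closed; `μ := Measure.haar` (regular); `μ` RIGHT
invariant by `CocompactLattice.isMulRightInvariant_of_cocompactLattice`; `𝓕` a measurable right fundamental
domain of `Γ` (pv09-g4 `exists_isFundamentalDomain_op_finite`). -/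
def ofLattice (G : Type) [Group G] [TopologicalSpace G] [IsTopologicalGroup G] [LocallyCompactSpace G]
    [T2Space G] [SecondCountableTopology G] (Γ : Subgroup G) [DiscreteTopology Γ] [CompactSpace (G ⧸ Γ)] :
    QuotientModel :=
  letI : MeasurableSpace G := borel G
  haveI : BorelSpace G := ⟨rfl⟩
  haveI : Countable Γ := countable_of_discrete Γ
  haveI : (Measure.haar (G := G)).IsMulRightInvariant :=
    CocompactLattice.isMulRightInvariant_of_cocompactLattice Γ Measure.haar
  { G := G
    Γ := Γ
    isClosed_Γ := Subgroup.isClosed_of_discrete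
    μ := Measure.haar
    𝓕 := (exists_isFundamentalDomain_op_finite Γ (Measure.haar (G := G))).choose
    isFundamentalDomain := (exists_isFundamentalDomain_op_finite Γ (Measure.haar (G := G))).choose_spec.2.1 }

section

variable (G : Type) [Group G] [TopologicalSpace G] [IsTopologicalGroup G] [LocallyCompactSpace G]
  [T2Space G] [SecondCountableTopology G] (Γ : Subgroup G) [DiscreteTopology Γ] [CompactSpace (G ⧸ Γ)]

/-- (Ported verbatim from the HodgeCMPerL package; no docstring in the source.) -/
@[simp] theorem ofLattice_G : (ofLattice G Γ).G = G := rfl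

/-- (Ported verbatim from the HodgeCMPerL package; no docstring in the source.) -/
@[simp] theorem ofLattice_Γ : (ofLattice G Γ).Γ = Γ := rfl

/-- The fundamental domain of `ofLattice` is measurable (Borel) and of finite Haar measure. -/
theorem ofLattice_measurableSet_𝓕 : MeasurableSet[borel G] (ofLattice G Γ).𝓕 := by
  letI : MeasurableSpace G := borel G
  haveI : BorelSpace G := ⟨rfl⟩
  haveI : Countable Γ := countable_of_discrete Γ
  exact (exists_isFundamentalDomain_op_finite Γ (Measure.haar (G := G))).choose_spec.1

/-- (Ported verbatim from the HodgeCMPerL package; no docstring in the source.) -/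
theorem ofLattice_measure_𝓕_lt_top : (ofLattice G Γ).μ (ofLattice G Γ).𝓕 < ⊤ := by
  letI : MeasurableSpace G := borel G
  haveI : BorelSpace G := ⟨rfl⟩
  haveI : Countable Γ := countable_of_discrete Γ
  exact (exists_isFundamentalDomain_op_finite Γ (Measure.haar (G := G))).choose_spec.2.2.2

/-- `hfc` of the END STATEs over models holds for lattice models. -/
instance firstCountableTopology_ofLattice : FirstCountableTopology (ofLattice G Γ).G :=
  inferInstanceAs (FirstCountableTopology G)

/-- (Ported verbatim from the HodgeCMPerL package; no docstring in the source.) -/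
instance t2Space_ofLattice : T2Space (ofLattice G Γ).G := inferInstanceAs (T2Space G)

/-- (Ported verbatim from the HodgeCMPerL package; no docstring in the source.) -/
instance secondCountableTopology_ofLattice : SecondCountableTopology (ofLattice G Γ).G :=
  inferInstanceAs (SecondCountableTopology G)

end

end QuotientModel

/-! ## Sanity: the constructor applies to a concrete compact group -/

section ModelSanity

/-- The compact second countable group `Circle` with the trivial (discrete, cocompact) lattice `⊥` is a
`QuotientModel` by `ofLattice` — all instances found by Mathlib. -/
example : QuotientModel := QuotientModel.ofLattice Circle ⊥

/-- … and its Haar measure is right invariant by the general theorem (here also because `Circle` is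
commutative). -/
example : (QuotientModel.ofLattice Circle ⊥).μ.IsMulRightInvariant := inferInstance

end ModelSanity

end HodgeCM

end
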